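import Literature.Geometry.Riemannian.HeatKernelGaussianIntegralBound
import HarnessLib

/-!
# Exponential moments of the distance from an `H_m`-centre under the conjugate heat kernel
# measures (Bamler 2020a, §7.2, proof of Thm. 7.1)

R. Bamler, *Entropy and heat kernel bounds on a Ricci flow background*, arXiv:2008.07093 (2020a),
§7.2: in the proof of the heat kernel upper bound (Thm. 7.1) one needs, for an `H_n`-centre
`(z, s)` of `(x, t)` (`Var_s(δ_z, ν_{x,t;s}) ≤ H_n (t − s)`, `H_n = (n − 1)π²/2 + 4`), that all
exponential moments of the distance `d_s(z, ·)` under `ν = ν_{x,t;s}` are controlled,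

  `∫ exp(κ d_s(z, y)) dν(y) ≤ C exp(C κ² (t − s) + κ √(2 H_n (t − s)))`   (`κ ≥ 0`);

Bamler obtains this from the Gaussian integral bound Thm. 3.12 by the layer-cake formula.

This file proves it (`integral_exp_mul_edist_heatKernelMeasure_le`, with `C = 3` in front and
`8 κ² (t − s)` in the exponent) for a Ricci flow `hflow = (h, cov)` on `[a, T]` of a `C^∞` family
of Riemannian metrics on a closed connected manifold `M` modelled on `ℝᵐ`, `a < s < t ≤ T`, the
tree's heat kernel measures `ν = heatKernelMeasure hh hR t x s` (`HeatKernelMeasures.lean`) and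
Riemannian distance `(h s).edist (hR s)` (`RiemannianDistance.lean`). Instead of integrating the
tail bound of Thm. 3.12 we run the argument behind it once more, which is shorter to formalise:
the `1`-Lipschitz function `ψ = d_s(z, ·)` is smoothed (`exists_contMDiff_abs_sub_lt_gradSq_le`,
`|χ − ψ| < ε`, `|∇χ|² ≤ (1 + ε)²`), the log-Sobolev inequality of Hein–Naber gives the entropy
bound `entropy_exp_mul_le_of_gradSq_le` for `e^{lχ}`, Herbst's argument
(`Literature.Probability.Moments.herbst_laplace_and_tail_bound`) the Laplace bound
`∫ e^{κ(χ − ∫χ dν)} dν ≤ e^{(t − s)(1 + ε)² κ²}`, hence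
`∫ e^{κψ} dν ≤ exp(2κε + (t − s)(1 + ε)²κ² + κ ∫ ψ dν)`
(`integral_exp_mul_heatKernelMeasure_le_of_lipschitz`); the `H_m`-centre hypothesis bounds the
mean `∫ ψ dν ≤ √(2 H_m (t − s))` (Cauchy–Schwarz in AM–GM form), and `ε = 1/(2κ + 2)` gives
`e^{2κε} ≤ e ≤ 3`, `(1 + ε)² ≤ 8`.

Everything is proved; no definitions, no named facts. What is NOT here: the notion of an
`H_n`-centre and their existence (Bamler 2020a, Prop. 3.13), the heat kernel upper bound
Thm. 7.1 itself, lower exponential moments / moments of powers of the distance, non-compact `M`.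

## References

* R. H. Bamler, *Entropy and heat kernel bounds on a Ricci flow background*, arXiv:2008.07093
  (2020), §3.1 Thm. 3.12, §7.2 proof of Thm. 7.1. [Bamler2020Entropy]
* H.-J. Hein, A. Naber, *New logarithmic Sobolev inequalities and an ε-regularity theorem for the
  Ricci flow*, Comm. Pure Appl. Math. 67 (2014), 1543–1561, §3.2 (Herbst's argument for the heat
  kernel measures). [HeinNaber2014]
* D. Bakry, I. Gentil, M. Ledoux, *Analysis and Geometry of Markov Diffusion Operators*,
  Grundlehren 348, Springer (2014), Prop. 5.4.1. [BakryGentilLedoux2014]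
-/

noncomputable section

open Bundle Set Function Filter Manifold MeasureTheory Measure TopologicalSpace
open scoped Manifold ContDiff Topology ENNReal NNReal

namespace Literature.Geometry.Riemannian

open Lorentzian Lorentzian.PseudoRiemannianMetric

section LipschitzLaplace

variable {m : ℕ} {H : Type*} [TopologicalSpace H]
  {I : ModelWithCorners ℝ (EuclideanSpace ℝ (Fin m)) H} [I.Boundaryless]
  {M : Type*} [TopologicalSpace M] [ChartedSpace H M] [IsManifold I ∞ M]
  [T2Space M] [CompactSpace M] [SecondCountableTopology M] [MeasurableSpace M] [BorelSpace M]
  [PreconnectedSpace M]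
  {h : ℝ → PseudoRiemannianMetric I ∞ (EuclideanSpace ℝ (Fin m)) (TangentSpace I : M → Type _)}
  {cov : ℝ → CovariantDerivative I (EuclideanSpace ℝ (Fin m)) (TangentSpace I : M → Type _)}
  {a T : ℝ}

/-- **Exponential moments of a `1`-Lipschitz function under the heat kernel measures**
(Hein–Naber 2014, §3.2, Herbst's argument, with the smoothing slack `ε` kept explicit). Let
`(h, cov)` be a Ricci flow on `[a, T]` of a smooth family of Riemannian metrics on a closed
connected manifold `M`, `a < s < t ≤ T`, `ν = ν_{x,t;s}`, and `ψ : M → ℝ` continuous with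
`|ψ y − ψ w| ≤ d_s(y, w)`. Then for `κ ≥ 0` and every `ε > 0`

  `∫ e^{κψ} dν ≤ exp(2κε + (t − s)(1 + ε)² κ² + κ ∫ ψ dν)`.

Proof: smooth `χ` with `|χ − ψ| < ε`, `|∇χ|²_{h(s)} ≤ (1 + ε)²`
(`exists_contMDiff_abs_sub_lt_gradSq_le`); the entropy bound `entropy_exp_mul_le_of_gradSq_le`
and Herbst's argument give `∫ e^{κ(χ − ∫χ)} dν ≤ e^{(t − s)(1 + ε)²κ²}`; finally
`e^{κψ} ≤ e^{κε} e^{κχ}` and `∫ χ ≤ ∫ ψ + ε`.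
[cite: HeinNaber2014, §3.2, proof of the Gaussian concentration theorem] -/
theorem integral_exp_mul_heatKernelMeasure_le_of_lipschitz (hflow : IsRicciFlow h cov (Icc a T))
    (hh : IsContMDiffFamilyOn ∞ h univ) (hR : ∀ r, (h r).IsRiemannian) {s t : ℝ} (has : a < s)
    (hst : s < t) (htT : t ≤ T) (x : M) {ψ : M → ℝ} (hψc : Continuous ψ)
    (hψ : ∀ y w, ENNReal.ofReal |ψ y - ψ w| ≤ (h s).edist (hR s) y w)
    {κ ε : ℝ} (hκ : 0 ≤ κ) (hε : 0 < ε) :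
    ∫ y, Real.exp (κ * ψ y) ∂(heatKernelMeasure hh hR t x s) ≤
      Real.exp (2 * κ * ε + (t - s) * (1 + ε) ^ 2 * κ ^ 2 +
        κ * ∫ y, ψ y ∂(heatKernelMeasure hh hR t x s)) := by
  set ν := heatKernelMeasure hh hR t x s with hν
  have hτ : 0 < t - s := sub_pos.2 hst
  -- smoothing of the Lipschitz function
  obtain ⟨χ, hχs, hχψ, hχg⟩ := exists_contMDiff_abs_sub_lt_gradSq_le (h s) (hR s) hψc
    zero_le_one (F := ψ) (fun y w ↦ by rw [ENNReal.ofReal_one, one_mul]; exact hψ y w) hε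
  have hc : 0 < (t - s) * (1 + ε) ^ 2 := by positivity
  have hχc : Continuous χ := hχs.continuous
  have hχm : Measurable χ := hχc.measurable
  obtain ⟨C, hC⟩ : ∃ C : ℝ, ∀ y, |χ y| ≤ C := by
    obtain ⟨C, hC⟩ := isCompact_univ.exists_bound_of_continuousOn hχc.continuousOn
    exact ⟨C, fun y ↦ by simpa [Real.norm_eq_abs] using hC y (mem_univ y)⟩
  -- log-Sobolev ⟹ entropy bound ⟹ Herbst's Laplace bound
  have hEnt := entropy_exp_mul_le_of_gradSq_le hflow hh hR has hst htT x hχs hχg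
  have hLap := (Literature.Probability.Moments.herbst_laplace_and_tail_bound ν hχm ⟨C, hC⟩ hc
    hEnt).1 κ
  -- continuous functions on the compact `M` are `ν`-integrable
  have hint : ∀ {f : M → ℝ}, Continuous f → Integrable f ν := fun hf ↦
    hf.integrable_of_hasCompactSupport (HasCompactSupport.of_compactSpace _)
  -- `∫ χ ≤ ∫ ψ + ε`
  have hχψi : ∫ y, χ y ∂ν ≤ (∫ y, ψ y ∂ν) + ε := by
    calc ∫ y, χ y ∂ν ≤ ∫ y, (ψ y + ε) ∂ν :=
          integral_mono (hint hχc) ((hint hψc).add (integrable_const ε)) fun y ↦ by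
            have := (abs_lt.1 (hχψ y)).2
            simp only
            linarith
      _ = (∫ y, ψ y ∂ν) + ε := by
          rw [integral_add (hint hψc) (integrable_const ε), integral_const, smul_eq_mul,
            probReal_univ, one_mul]
  -- `e^{κψ} ≤ e^{κε + κ ∫χ} · e^{κ(χ − ∫χ)}`, integrate, and use the Laplace bound
  set mχ : ℝ := ∫ y, χ y ∂ν with hmχ
  calc ∫ y, Real.exp (κ * ψ y) ∂ν
      ≤ ∫ y, Real.exp (κ * ε + κ * mχ) * Real.exp (κ * (χ y - mχ)) ∂ν := by
        refine integral_mono (hint (by fun_prop)) (hint (by fun_prop)) fun y ↦ ?_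
        simp only
        rw [← Real.exp_add]
        refine Real.exp_le_exp.2 ?_
        have h1 : κ * ψ y ≤ κ * (χ y + ε) :=
          mul_le_mul_of_nonneg_left (by linarith [(abs_lt.1 (hχψ y)).1]) hκ
        linarith
    _ = Real.exp (κ * ε + κ * mχ) * ∫ y, Real.exp (κ * (χ y - mχ)) ∂ν :=
        integral_const_mul _ _
    _ ≤ Real.exp (κ * ε + κ * mχ) * Real.exp ((t - s) * (1 + ε) ^ 2 * κ ^ 2) :=
        mul_le_mul_of_nonneg_left hLap (Real.exp_pos _).le
    _ = Real.exp (κ * ε + κ * mχ + (t - s) * (1 + ε) ^ 2 * κ ^ 2) := (Real.exp_add _ _).symm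
    _ ≤ Real.exp (2 * κ * ε + (t - s) * (1 + ε) ^ 2 * κ ^ 2 + κ * ∫ y, ψ y ∂ν) := by
        refine Real.exp_le_exp.2 ?_
        have h1 : κ * mχ ≤ κ * ((∫ y, ψ y ∂ν) + ε) := mul_le_mul_of_nonneg_left hχψi hκ
        linarith

end LipschitzLaplace

section ExponentialMoment

/-- **Exponential moments of the distance from an `H_m`-centre** (Bamler 2020a, §7.2, the
layer-cake displays in the proof of Thm. 7.1, from the Gaussian integral bound Thm. 3.12). Let
`(h, cov)` be a Ricci flow on `[a, T]` of a smooth family of Riemannian metrics on a closed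
connected manifold `M` modelled on `ℝᵐ` (`m ≥ 1`), `a < s < t ≤ T`, `x ∈ M`, `ν = ν_{x,t;s}` the
conjugate heat kernel measure, and `z` an `H_m`-centre of `(x, t)` at time `s`:
`∫ d_s(z, y)² dν(y) ≤ H_m (t − s)`, `H_m = (m − 1)π²/2 + 4`. Then for every `κ ≥ 0`

  `∫ exp(κ d_s(z, y)) dν(y) ≤ 3 exp(8 κ² (t − s) + κ √(2 H_m (t − s)))`.

Proof: `ψ = d_s(z, ·)` is continuous and `1`-Lipschitz, so
`integral_exp_mul_heatKernelMeasure_le_of_lipschitz` (Hein–Naber's Herbst argument, the engine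
of Bamler's Thm. 3.12) gives `∫ e^{κψ} dν ≤ exp(2κε + (t − s)(1 + ε)²κ² + κ ∫ψ dν)` for every
`ε > 0`; the centre hypothesis gives `∫ ψ dν ≤ (∫ ψ²)/(2A) + A/2 ≤ A`, `A = √(2 H_m (t − s))`;
take `ε = 1/(2κ + 2)`, so that `e^{2κε} ≤ e ≤ 3` and `(1 + ε)² ≤ 8`.
[cite: Bamler2020Entropy, §7.2, proof of Thm. 7.1] -/
theorem integral_exp_mul_edist_heatKernelMeasure_le {m : ℕ} {H : Type*} [TopologicalSpace H]
    {I : ModelWithCorners ℝ (EuclideanSpace ℝ (Fin m)) H} [I.Boundaryless]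
    {M : Type*} [TopologicalSpace M] [ChartedSpace H M] [IsManifold I ∞ M]
    [T2Space M] [CompactSpace M] [SecondCountableTopology M] [MeasurableSpace M] [BorelSpace M]
    [ConnectedSpace M]
    {h : ℝ → PseudoRiemannianMetric I ∞ (EuclideanSpace ℝ (Fin m)) (TangentSpace I : M → Type _)}
    {cov : ℝ → CovariantDerivative I (EuclideanSpace ℝ (Fin m)) (TangentSpace I : M → Type _)}
    {a T : ℝ} (hflow : IsRicciFlow h cov (Icc a T))
    (hh : IsContMDiffFamilyOn ∞ h univ) (hR : ∀ r, (h r).IsRiemannian) (hm : 0 < m) {s t : ℝ}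
    (has : a < s) (hst : s < t) (htT : t ≤ T) (x z : M)
    (hz : ∫⁻ y, (h s).edist (hR s) z y ^ 2 ∂(heatKernelMeasure hh hR t x s) ≤
      ENNReal.ofReal ((((m : ℝ) - 1) * Real.pi ^ 2 / 2 + 4) * (t - s)))
    {κ : ℝ} (hκ : 0 ≤ κ) :
    ∫ y, Real.exp (κ * ((h s).edist (hR s) z y).toReal) ∂(heatKernelMeasure hh hR t x s) ≤
      3 * Real.exp (8 * κ ^ 2 * (t - s) +
        κ * Real.sqrt (2 * ((((m : ℝ) - 1) * Real.pi ^ 2 / 2 + 4) * (t - s)))) := by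
  set ν := heatKernelMeasure hh hR t x s with hν
  set Hm : ℝ := ((m : ℝ) - 1) * Real.pi ^ 2 / 2 + 4 with hHm
  set A : ℝ := Real.sqrt (2 * (Hm * (t - s))) with hA
  have hτ : 0 < t - s := sub_pos.2 hst
  have hm1 : (1 : ℝ) ≤ m := by exact_mod_cast hm
  have hHm0 : 0 < Hm := by
    have : 0 ≤ ((m : ℝ) - 1) * Real.pi ^ 2 / 2 := by
      have := sub_nonneg.2 hm1
      positivity
    rw [hHm]
    linarith
  have hHτ : 0 < Hm * (t - s) := mul_pos hHm0 hτ
  have hA0 : 0 < A := Real.sqrt_pos.2 (by positivity)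
  have hA2 : A ^ 2 = 2 * (Hm * (t - s)) := Real.sq_sqrt (by positivity)
  -- the `1`-Lipschitz witness `ψ = d_s(z, ·)`
  have hcont : Continuous fun y ↦ (h s).edist (hR s) z y :=
    ((h s).continuous_edist (hR s)).comp (.prodMk_right z)
  have hfin : ∀ y, (h s).edist (hR s) z y ≠ ⊤ := fun y ↦
    PseudoRiemannianMetric.edist_ne_top (hR s) z y
  set ψ : M → ℝ := fun y ↦ ((h s).edist (hR s) z y).toReal with hψ
  have hψc : Continuous ψ := continuous_iff_continuousAt.2 fun y ↦
    (ENNReal.tendsto_toReal (hfin y)).comp (hcont.tendsto y)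
  have hψL : ∀ y w, ENNReal.ofReal |ψ y - ψ w| ≤ (h s).edist (hR s) y w := by
    intro y w
    have hyw : (h s).edist (hR s) y w ≠ ⊤ := PseudoRiemannianMetric.edist_ne_top (hR s) y w
    refine ENNReal.ofReal_le_of_le_toReal (abs_sub_le_iff.2 ⟨?_, ?_⟩)
    · have h1 : (h s).edist (hR s) z y ≤ (h s).edist (hR s) z w + (h s).edist (hR s) y w := by
        rw [PseudoRiemannianMetric.edist_comm (hR s) y w]
        exact PseudoRiemannianMetric.edist_triangle (hR s) z w y
      have h2 := ENNReal.toReal_mono (ENNReal.add_ne_top.2 ⟨hfin w, hyw⟩) h1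
      rw [ENNReal.toReal_add (hfin w) hyw] at h2
      simp only [hψ]
      linarith
    · have h1 : (h s).edist (hR s) z w ≤ (h s).edist (hR s) z y + (h s).edist (hR s) y w :=
        PseudoRiemannianMetric.edist_triangle (hR s) z y w
      have h2 := ENNReal.toReal_mono (ENNReal.add_ne_top.2 ⟨hfin y, hyw⟩) h1
      rw [ENNReal.toReal_add (hfin y) hyw] at h2
      simp only [hψ]
      linarith
  have hψ0 : ∀ y, 0 ≤ ψ y := fun y ↦ ENNReal.toReal_nonneg
  -- integrability on the compact `M`
  have hψi : Integrable ψ ν :=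
    hψc.integrable_of_hasCompactSupport (HasCompactSupport.of_compactSpace _)
  have hψ2i : Integrable (fun y ↦ ψ y ^ 2) ν :=
    (hψc.pow 2).integrable_of_hasCompactSupport (HasCompactSupport.of_compactSpace _)
  -- the centre hypothesis as a Bochner integral: `∫ ψ² dν ≤ H_m (t - s)`
  have h2 : ∫ y, ψ y ^ 2 ∂ν ≤ Hm * (t - s) := by
    have heq : ∫⁻ y, (h s).edist (hR s) z y ^ 2 ∂ν = ∫⁻ y, ENNReal.ofReal (ψ y ^ 2) ∂ν := by
      refine lintegral_congr fun y ↦ ?_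
      rw [ENNReal.ofReal_pow (hψ0 y), ENNReal.ofReal_toReal (hfin y)]
    have hz' := hz
    rw [heq, ← ofReal_integral_eq_lintegral_ofReal hψ2i (ae_of_all _ fun y ↦ sq_nonneg (ψ y))]
      at hz'
    exact (ENNReal.ofReal_le_ofReal_iff hHτ.le).1 hz'
  -- the mean: `∫ ψ dν ≤ (∫ ψ²)/(2A) + A/2 ≤ A`
  have h1 : ∫ y, ψ y ∂ν ≤ A := by
    have hpt : ∀ y, ψ y ≤ ψ y ^ 2 / (2 * A) + A / 2 := by
      intro y
      have hsq := sq_nonneg (ψ y - A)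
      rw [div_add_div _ _ (by positivity) (by norm_num), le_div_iff₀ (by positivity)]
      nlinarith
    calc ∫ y, ψ y ∂ν ≤ ∫ y, (ψ y ^ 2 / (2 * A) + A / 2) ∂ν :=
          integral_mono hψi ((hψ2i.div_const _).add (integrable_const _)) hpt
      _ = (∫ y, ψ y ^ 2 ∂ν) / (2 * A) + A / 2 := by
          rw [integral_add (hψ2i.div_const _) (integrable_const _), integral_div, integral_const,
            smul_eq_mul, probReal_univ, one_mul]
      _ ≤ Hm * (t - s) / (2 * A) + A / 2 := by gcongr
      _ = A / 4 + A / 2 := by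
          rw [show Hm * (t - s) = A ^ 2 / 2 by rw [hA2]; ring]
          field_simp
          ring
      _ ≤ A := by linarith
  -- the smoothing slack `ε = 1/(2κ + 2)`
  set ε : ℝ := 1 / (2 * κ + 2) with hε
  have hε0 : 0 < ε := by positivity
  have hε1 : ε ≤ 1 := by
    rw [hε, div_le_one (by positivity)]
    linarith
  have hκε : 2 * κ * ε ≤ 1 := by
    rw [hε, mul_one_div, div_le_one (by positivity)]
    linarith
  have hmain := integral_exp_mul_heatKernelMeasure_le_of_lipschitz hflow hh hR has hst htT x
    hψc hψL hκ hε0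
  refine hmain.trans ?_
  have h3 : Real.exp (2 * κ * ε) ≤ 3 :=
    ((Real.exp_le_exp.2 hκε).trans Real.exp_one_lt_three.le)
  have hX : (t - s) * (1 + ε) ^ 2 * κ ^ 2 + κ * ∫ y, ψ y ∂ν ≤ 8 * κ ^ 2 * (t - s) + κ * A := by
    have h1' : κ * ∫ y, ψ y ∂ν ≤ κ * A := mul_le_mul_of_nonneg_left h1 hκ
    have h8 : (1 + ε) ^ 2 ≤ 8 := by nlinarith
    have hk : 0 ≤ κ ^ 2 * (t - s) := by positivity
    nlinarith
  calc Real.exp (2 * κ * ε + (t - s) * (1 + ε) ^ 2 * κ ^ 2 + κ * ∫ y, ψ y ∂ν)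
      = Real.exp (2 * κ * ε) * Real.exp ((t - s) * (1 + ε) ^ 2 * κ ^ 2 + κ * ∫ y, ψ y ∂ν) := by
        rw [← Real.exp_add, add_assoc]
    _ ≤ 3 * Real.exp (8 * κ ^ 2 * (t - s) + κ * A) :=
        mul_le_mul h3 (Real.exp_le_exp.2 hX) (Real.exp_pos _).le (by norm_num)

end ExponentialMoment

end Literature.Geometry.Riemannian
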